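import Literature.NumberTheory.EllipticCurves.LocalKummerIsotropyTransport
import HarnessLib

/-!
# `H⁰(F, E[n]) = E(F)[n]`: the invariants of the local torsion module are the rational torsion points

Topic `NumberTheory/EllipticCurves`; namespace `WeierstrassCurve`. Definitions with bodies and theorems
only: **no named fact is introduced** (D-0026).

For an elliptic curve `E = W` over a field `K` of characteristic `0`, a `K`-field `F` (a completion
`K_v`) and `n ≠ 0`, the `Γ_F`-invariants of the restricted torsion module `E[n](K̄)|_{Γ_F}`
(`GaloisRep.restrictField F (W.torsionGaloisModule n)`, the coefficient module of the local conditions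
and local dualities of the tree) are identified with the `n`-torsion of **Mathlib's group of
`F`-rational points** of `W⁄F`:

* `kerZSMulToInvariants W F hn : (W⁄F)(F)[n] →+ (E[n](K̄)|_{Γ_F})^{Γ_F}`, `P ↦ A⁻¹(P)` (`A` the torsion
  transfer `torsionTransferEquiv` of `LocalKummerIsotropyTransport.lean`, `P` read in `(W⁄F)(F̄)` through
  `toGeomPoints`), bijective (`kerZSMulToInvariants_bijective`: injectivity of `toGeomPoints`, and
  Galois descent `E(F̄)^{Γ_F} = E(F)` over the perfect field `F`, tree `mem_range_toGeomPoints_iff`);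
* `invariantsTorsionEquivKerZSMul : (E[n](K̄)|_{Γ_F})^{Γ_F} ≃+ (W⁄F)(F)[n]` and
  **`natCard_galoisCohomology_zero_torsion_restrictField`**:
  `#H⁰(F, E[n]) = #E(F)[n]` (`= #ker (n • ·)` on `(W⁄F).toAffine.Point`; tree
  `galoisCohomologyZeroEquiv : H⁰ ≃+ invariants`), with the `ℕ`-level version
  `natCard_galoisCohomology_zero_torsion_restrictField_nat` (`ker (nsmulAddMonoidHom n)`).

This is the factor `#H⁰(K_v, E[n]) = #E(K_v)[n]` of Tate's local Euler characteristic formula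
`#H¹(K_v, E[n]) = #H⁰ · #H² · #(𝓞_v/n²𝓞_v)` (Milne, *ADT*, I Thm. 2.8) in the form used by this unit's
`LocalTateDualityOrderForE.lean` (`#H¹(K_v, E[n]) = (#E(K_v)[n] · #(𝓞_v/n))²`).
Silverman, *AEC*, VIII.§1 (Galois descent for points), X.§4; Milne, *ADT*, I §2–§3.
Motivation: provefact `WeierstrassCurve.exists_casselsTate_pairing`.

## References

* [SilvermanAEC2009] J. H. Silverman, *The Arithmetic of Elliptic Curves*, 2nd ed. (2009), VIII.§1
  (proof of Prop. 1.2: `E(K̄)^{G} = E(K)`), X.§4.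
* [MilneADT2006] J. S. Milne, *Arithmetic Duality Theorems*, 2nd ed. (2006), Ch. I, Thm. 2.8, §3.
-/

noncomputable section

open scoped Classical

universe u

namespace WeierstrassCurve

open Literature.NumberTheory.EllipticCurves Literature.NumberTheory.GaloisRepresentations Field Function

variable {K : Type u} [Field K] [CharZero K] (W : WeierstrassCurve K) [W.IsElliptic]
variable (F : Type u) [Field F] [Algebra K F] {n : ℤ}

omit [CharZero K] [W.IsElliptic] in
/-- The restricted torsion module acts through `Γ_F → Γ_K`: `ρ|_F σ T = (res σ) • T`. [folklore] -/
theorem restrictField_torsionGaloisModule_apply (σ : absoluteGaloisGroup F) (T : geomTorsion W n) :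
    (GaloisRep.restrictField F (W.torsionGaloisModule n)) σ T = absGaloisRestrict K F σ • T :=
  rfl

omit [CharZero K] [W.IsElliptic] in
/-- The image in `(W⁄F)(F̄)` of an `F`-rational point `P` with `n • P = 0` is an `n`-torsion geometric
point. [folklore] -/
theorem toGeomPoints_mem_geomTorsion_of_mem_ker
    (P : (zsmulAddGroupHom n : (W.baseChange F).toAffine.Point →+ _).ker) :
    toGeomPoints (W.baseChange F) (P : (W.baseChange F).toAffine.Point) ∈
      geomTorsion (W.baseChange F) n := by
  rw [mem_geomTorsion_iff, ← map_zsmul]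
  have h : n • (P : (W.baseChange F).toAffine.Point) = 0 := P.2
  rw [h, map_zero]

/-- **`(W⁄F)(F)[n] → (E[n](K̄)|_{Γ_F})^{Γ_F}`, `P ↦ A⁻¹(P)`**: an `F`-rational `n`-torsion point of
`W⁄F`, read in `(W⁄F)[n](F̄)` and transferred to `E[n](K̄)` by the inverse torsion transfer
`A⁻¹ = (torsionTransferEquiv hn)⁻¹`, is `Γ_F`-invariant (`A⁻¹` is equivariant,
`torsionTransferEquiv_symm_smul`, and rational points are Galois-fixed, `smul_toGeomPoints`).
Silverman, *AEC*, VIII.§1. [folklore] -/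
def kerZSMulToInvariants (hn : n ≠ 0) :
    (zsmulAddGroupHom n : (W.baseChange F).toAffine.Point →+ _).ker →+
      (GaloisRep.restrictField F (W.torsionGaloisModule n)).invariants where
  toFun P := ⟨(W.torsionTransferEquiv (E := F) hn).symm
      ⟨toGeomPoints (W.baseChange F) (P : (W.baseChange F).toAffine.Point),
        W.toGeomPoints_mem_geomTorsion_of_mem_ker F P⟩, by
    rw [ContinuousRep.mem_invariants]
    intro σ
    rw [restrictField_torsionGaloisModule_apply, ← torsionTransferEquiv_symm_smul]
    exact congrArg (W.torsionTransferEquiv (E := F) hn).symm (Subtype.ext (by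
      rw [AddSubgroup.torsionBy.coe_smul]
      exact smul_toGeomPoints (W.baseChange F) σ _))⟩
  map_zero' := by
    apply Subtype.ext
    change (W.torsionTransferEquiv (E := F) hn).symm _ = 0
    rw [← map_zero (W.torsionTransferEquiv (E := F) hn).symm]
    exact congrArg (W.torsionTransferEquiv (E := F) hn).symm
      (Subtype.ext (map_zero (toGeomPoints (W.baseChange F))))
  map_add' P Q := by
    apply Subtype.ext
    change (W.torsionTransferEquiv (E := F) hn).symm _ =
      (W.torsionTransferEquiv (E := F) hn).symm _ + (W.torsionTransferEquiv (E := F) hn).symm _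
    rw [← map_add]
    exact congrArg (W.torsionTransferEquiv (E := F) hn).symm
      (Subtype.ext (map_add (toGeomPoints (W.baseChange F)) _ _))

/-- Unfolding `kerZSMulToInvariants` after the torsion transfer: `A (κ P) = toGeomPoints P` in
`(W⁄F)[n](F̄)`. [folklore] -/
theorem torsionTransferEquiv_kerZSMulToInvariants (hn : n ≠ 0)
    (P : (zsmulAddGroupHom n : (W.baseChange F).toAffine.Point →+ _).ker) :
    ((W.torsionTransferEquiv (E := F) hn
        ((W.kerZSMulToInvariants F hn P : (GaloisRep.restrictField F
          (W.torsionGaloisModule n)).invariants) : geomTorsion W n) :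
        geomTorsion (W.baseChange F) n) : geomPoints (W.baseChange F)) =
      toGeomPoints (W.baseChange F) (P : (W.baseChange F).toAffine.Point) := by
  change (((W.torsionTransferEquiv (E := F) hn) ((W.torsionTransferEquiv (E := F) hn).symm _) :
    geomTorsion (W.baseChange F) n) : geomPoints (W.baseChange F)) = _
  rw [AddEquiv.apply_symm_apply]

variable [CharZero F]

/-- **`kerZSMulToInvariants` is bijective**: injective since `toGeomPoints` and `A⁻¹` are; surjective
by Galois descent over the perfect field `F` (`E(F̄)^{Γ_F} = E(F)`, tree `mem_range_toGeomPoints_iff`):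
a `Γ_F`-invariant `T ∈ E[n](K̄)` has `A T ∈ (W⁄F)[n](F̄)` Galois-fixed (`torsionTransferEquiv_smul`),
hence rational. Silverman, *AEC*, VIII.§1 (proof of Prop. 1.2). [cite: SilvermanAEC2009, VIII.§1 (proof of Prop. 1.2)] -/
theorem kerZSMulToInvariants_bijective (hn : n ≠ 0) :
    Bijective (W.kerZSMulToInvariants F hn) := by
  constructor
  · intro P Q h
    apply Subtype.ext
    apply toGeomPoints_injective (W.baseChange F)
    rw [← W.torsionTransferEquiv_kerZSMulToInvariants F hn P,
      ← W.torsionTransferEquiv_kerZSMulToInvariants F hn Q, h]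
  · intro T
    -- `A T` is `Γ_F`-fixed in `(W⁄F)(F̄)`
    have hfix : ((W.torsionTransferEquiv (E := F) hn (T : geomTorsion W n) :
        geomTorsion (W.baseChange F) n) : geomPoints (W.baseChange F)) ∈
        MulAction.fixedPoints (absoluteGaloisGroup F) (geomPoints (W.baseChange F)) := fun σ => by
      rw [← AddSubgroup.torsionBy.coe_smul, ← torsionTransferEquiv_smul,
        ← restrictField_torsionGaloisModule_apply, (ContinuousRep.mem_invariants _ _).mp T.2 σ]
    obtain ⟨P, hP⟩ := (mem_range_toGeomPoints_iff (W.baseChange F) _).mpr hfix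
    have hPn : n • P = 0 := by
      apply toGeomPoints_injective (W.baseChange F)
      rw [map_zsmul, hP, map_zero]
      exact (mem_geomTorsion_iff (W.baseChange F) n _).mp
        (W.torsionTransferEquiv (E := F) hn (T : geomTorsion W n)).2
    refine ⟨⟨P, hPn⟩, Subtype.ext ((W.torsionTransferEquiv (E := F) hn).injective (Subtype.ext ?_))⟩
    rw [W.torsionTransferEquiv_kerZSMulToInvariants F hn]
    exact hP

/-- **`(E[n](K̄)|_{Γ_F})^{Γ_F} ≃+ (W⁄F)(F)[n]`**: the `Γ_F`-invariants of the local torsion module are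
the `F`-rational `n`-torsion points of `W⁄F` (inverse of `kerZSMulToInvariants`).
Silverman, *AEC*, VIII.§1; Milne, *ADT*, I §3 (`H⁰(K, A_n) = A(K)_n`). [folklore] -/
def invariantsTorsionEquivKerZSMul (hn : n ≠ 0) :
    (GaloisRep.restrictField F (W.torsionGaloisModule n)).invariants ≃+
      (zsmulAddGroupHom n : (W.baseChange F).toAffine.Point →+ _).ker :=
  (AddEquiv.ofBijective (W.kerZSMulToInvariants F hn) (W.kerZSMulToInvariants_bijective F hn)).symm

/-- **`#H⁰(F, E[n]) = #E(F)[n]`**: the order of `H⁰(Γ_F, E[n](K̄)|_{Γ_F})` (tree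
`galoisCohomologyZeroEquiv : H⁰ ≃+ invariants`) is the number of `F`-rational points `P` of `W⁄F` with
`n • P = 0` (both sides `0` if infinite). Milne, *ADT*, I §3 (`H⁰(K, A_n) = A(K)_n`, in Thm. 2.8 /
Lemma 3.3). [cite: MilneADT2006, I Lemma 3.3] -/
theorem natCard_galoisCohomology_zero_torsion_restrictField (hn : n ≠ 0) :
    Nat.card (galoisCohomology (GaloisRep.restrictField F (W.torsionGaloisModule n)) 0) =
      Nat.card (zsmulAddGroupHom n : (W.baseChange F).toAffine.Point →+ _).ker :=
  Nat.card_congr (((galoisCohomologyZeroEquiv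
    (GaloisRep.restrictField F (W.torsionGaloisModule n))).trans
      (W.invariantsTorsionEquivKerZSMul F hn)).toEquiv)

/-- The `ℕ`-level version: **`#H⁰(F, E[n]) = #ker (nsmulAddMonoidHom n)`** on `(W⁄F).toAffine.Point`
for `n : ℕ`, `n ≠ 0` (the form of `#E(K_v)[n]` in `LocalPointsIntegersSubgroup.lean` /
`LocalKummerMap.lean`). [cite: MilneADT2006, I Lemma 3.3] -/
theorem natCard_galoisCohomology_zero_torsion_restrictField_nat {n : ℕ} (hn : n ≠ 0) :
    Nat.card (galoisCohomology (GaloisRep.restrictField F (W.torsionGaloisModule n)) 0) =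
      Nat.card (nsmulAddMonoidHom n : (W.baseChange F).toAffine.Point →+ _).ker := by
  have hker : (nsmulAddMonoidHom n : (W.baseChange F).toAffine.Point →+ _).ker =
      (zsmulAddGroupHom (n : ℤ) : (W.baseChange F).toAffine.Point →+ _).ker := by
    ext P
    simp only [AddMonoidHom.mem_ker, zsmulAddGroupHom_apply, nsmulAddMonoidHom_apply, natCast_zsmul]
  rw [hker]
  exact W.natCard_galoisCohomology_zero_torsion_restrictField F (Int.natCast_ne_zero.mpr hn)

end WeierstrassCurve

end
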